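import Mathlib.Analysis.Normed.Module.Connected
import Mathlib.Topology.Homotopy.Equiv
import Literature.Geometry.Symplectic.JConvexMaximumPrinciple
import Literature.Geometry.Symplectic.EtnyrePlanarFilling
import Literature.Topology.FourManifolds.Gluing
import HarnessLib

/-!
# Crux `ConvexBisection.PlanarAcyclicBisectionRigidity`, line Sketch: helper `helper_connected_seam`

**The halves and the seam of a Stein bisection of a homotopy `4`-sphere are connected.**  Let
`M ≃ₕ S⁴` be bisected as `M = e₁(W₁) ∪ e₂(W₂)` by two smoothly embedded compact Stein domains
meeting exactly along the images of their boundaries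
(`range e₁ ∩ range e₂ = e₁ '' ∂W₁ = e₂ '' ∂W₂`).  Then `W₁`, `W₂` and the carrier of any boundary
datum `b₁` of `W₁` (`≅ ∂W₁`) are connected — the input the dictionary's first step
(`supportedPlanarMonodromy`, `PlanarMonodromy.lean`) needs.

Proof (point-set topology over two PROVED Stein facts of the tree):

* every connected component `C` of a compact Stein domain `W` meets `∂W` in a **nonempty
  preconnected** set (`SteinStructure.isPreconnected_boundary_inter_compOpens`,
  `EtnyrePlanarFilling.lean`: maximum principle + coindex `≥ 2` of a `J`-convex Morse function);
* `M` is connected, being homotopy equivalent to the path-connected `S⁴`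
  (`pathConnectedSpace_of_homotopyEquiv'`);
* the abstract gluing lemma `connectedSpace_of_closed_bisection`: if a connected space `M` is
  covered by two injective closed maps `f : A → M`, `g : B → M` with
  `range f ∩ range g = g '' T`, `B` locally connected and `T` meeting every component of `B` in
  a nonempty preconnected set, then `A` is connected.  Indeed, for a clopen `C ⊆ A` let `G ⊆ B`
  be the (clopen) union of the components `D` of `B` whose trace `T ∩ D` is mapped by `g` into
  `f '' C`; then `U = f '' C ∪ g '' G` and `V = f '' Cᶜ ∪ g '' Gᶜ` are closed, cover `M` and
  are disjoint (a common point lies on the seam `g '' T`, and the preconnected `g '' (T ∩ D)`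
  cannot meet both `f '' C` and `f '' Cᶜ`), so one of them is empty, whence `C = ∅` or
  `C = univ`; nonemptiness of `A` follows from that of `M` and `T ∩ D ≠ ∅`;
* applied to `(e₁, e₂, ∂W₂)` and to `(e₂, e₁, ∂W₁)` this gives `ConnectedSpace W₁` and
  `ConnectedSpace W₂`; finally `∂W₁ = ∂W₁ ∩ W₁` is then nonempty preconnected, and
  `b₁.incl : b₁.carrier → W₁` is an embedding onto `∂W₁`.
-/

noncomputable section

open scoped Manifold ContDiff Topology ContinuousMap
open Set Function Literature.Geometry.Symplectic Literature.Topology.FourManifolds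

-- the prescribed namespace `Summit.<S>.<P>.…` repeats `SmoothPoincare4` (S = P = SmoothPoincare4)
set_option linter.dupNamespace false

namespace Summit.SmoothPoincare4.SmoothPoincare4.Theorems.PlanarAcyclicBisectionRigidity.Sketch

/-- Local notation: the round `4`-sphere in `ℝ⁵`. -/
local notation "𝕊⁴" => (Metric.sphere (0 : EuclideanSpace ℝ (Fin 5)) 1)

/-- Local notation: the model space `ℝ⁴`. -/
local notation "E4" => EuclideanSpace ℝ (Fin 4)

/-- A space homotopy equivalent to a path-connected space is path connected: if `g ∘ f ≃ 𝟙`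
then `x ∼ g (f x)` along the homotopy, and `g` maps a path `f x ⇝ f y` to a path
`g (f x) ⇝ g (f y)` (path components are homotopy invariants). [folklore] -/
theorem pathConnectedSpace_of_homotopyEquiv' {X Y : Type*} [TopologicalSpace X]
    [TopologicalSpace Y] (e : X ≃ₕ Y) [PathConnectedSpace Y] : PathConnectedSpace X := by
  -- adapted from `Literature.Topology.FourManifolds.pathConnectedSpace_of_homotopyEquiv`
  -- (`HomotopyS4CompactProofs.lean`), restated here to keep the imports light
  obtain ⟨H⟩ := e.left_inv
  have hj : ∀ x : X, Joined (e.invFun (e.toFun x)) x := fun x => ⟨H.evalAt x⟩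
  refine ⟨⟨e.invFun (Classical.arbitrary Y)⟩, fun x y => ?_⟩
  exact ((hj x).symm.trans
    ⟨(PathConnectedSpace.somePath (e.toFun x) (e.toFun y)).map e.invFun.continuous⟩).trans (hj y)

/-- **Abstract gluing lemma.**  Let the connected space `M` be covered by the images of two
injective closed maps `f : A → M`, `g : B → M` (`g` continuous, `B` locally connected) with
`range f ∩ range g = g '' T` for a set `T ⊆ B` meeting every connected component of `B` in a
nonempty preconnected set.  Then `A` is connected.  For a clopen `C ⊆ A`, the union `G` of the
components `D` of `B` with `g '' (T ∩ D)` meeting `f '' C` is clopen, and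
`f '' C ∪ g '' G`, `f '' Cᶜ ∪ g '' Gᶜ` are disjoint closed sets covering `M`. [folklore] -/
theorem connectedSpace_of_closed_bisection {M A B : Type*} [TopologicalSpace M]
    [ConnectedSpace M] [TopologicalSpace A] [TopologicalSpace B] [LocallyConnectedSpace B]
    {f : A → M} {g : B → M} (hfi : Injective f) (hfc : IsClosedMap f) (hg : Continuous g)
    (hgi : Injective g) (hgc : IsClosedMap g) (T : Set B) (hcover : range f ∪ range g = univ)
    (hseam : range f ∩ range g = g '' T)
    (hT : ∀ d : B, IsPreconnected (T ∩ connectedComponent d) ∧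
      (T ∩ connectedComponent d).Nonempty) :
    ConnectedSpace A := by
  -- `A` is nonempty: otherwise `range g = M`, `T = ∅`, and a component of `B` misses `T`
  have hA : Nonempty A := by
    by_contra hA
    haveI : IsEmpty A := not_nonempty_iff.1 hA
    have hf0 : range f = ∅ := range_eq_empty f
    have hg1 : range g = univ := by simpa [hf0] using hcover
    have hT0 : g '' T = ∅ := by rw [← hseam, hf0, empty_inter]
    obtain ⟨m⟩ := (inferInstance : Nonempty M)
    obtain ⟨d, -⟩ : m ∈ range g := hg1 ▸ mem_univ m
    obtain ⟨d₀, hd₀T, -⟩ := (hT d).2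
    exact (image_eq_empty.1 hT0).subset hd₀T |>.elim
  -- preconnectedness through clopen sets
  haveI := hA
  refine connectedSpace_iff_clopen.2 ⟨hA, fun C hC => ?_⟩
  by_contra hne
  obtain ⟨hC0, hC1⟩ := not_or.1 hne
  -- `G`: the components of `B` whose trace on `T` is mapped into `f '' C`
  set G : Set B := {d | ∃ d₀ ∈ connectedComponent d, d₀ ∈ T ∧ g d₀ ∈ f '' C} with hGdef
  have hGsat : ∀ d d' : B, d' ∈ connectedComponent d → (d' ∈ G ↔ d ∈ G) := by
    intro d d' hd'
    simp only [hGdef, mem_setOf_eq, connectedComponent_eq hd']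
  have hGo : IsOpen G := by
    refine isOpen_iff_forall_mem_open.2 fun d hd => ⟨connectedComponent d, fun d' hd' =>
      (hGsat d d' hd').2 hd, isOpen_connectedComponent, mem_connectedComponent⟩
  have hGc : IsClosed G := by
    rw [← isOpen_compl_iff]
    refine isOpen_iff_forall_mem_open.2 fun d hd => ⟨connectedComponent d, fun d' hd' h =>
      hd ((hGsat d d' hd').1 h), isOpen_connectedComponent, mem_connectedComponent⟩
  -- range f splits
  have hrf : range f = f '' C ∪ f '' Cᶜ := by rw [← image_union, union_compl_self, image_univ]
  have hdf : f '' C ∩ f '' Cᶜ = ∅ := by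
    rw [← image_inter hfi, inter_compl_self, image_empty]
  -- a seam point of `range g` is the image of a point of `T`
  have hmemT : ∀ {a : A} {d : B}, f a = g d → d ∈ T := by
    intro a d h
    have hm : g d ∈ g '' T := hseam ▸ ⟨⟨a, h⟩, ⟨d, rfl⟩⟩
    obtain ⟨d₁, hd₁, he⟩ := hm
    exact hgi he ▸ hd₁
  -- the two closed pieces
  set U : Set M := f '' C ∪ g '' G with hUdef
  set V : Set M := f '' Cᶜ ∪ g '' Gᶜ with hVdef
  have hU : IsClosed U := (hfc _ hC.1).union (hgc _ hGc)
  have hV : IsClosed V := (hfc _ hC.compl.1).union (hgc _ hGo.isClosed_compl)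
  have hUV : univ ⊆ U ∪ V := by
    rintro p -
    rcases (hcover.symm ▸ mem_univ p : p ∈ range f ∪ range g) with ⟨a, rfl⟩ | ⟨d, rfl⟩
    · by_cases ha : a ∈ C
      · exact Or.inl (Or.inl ⟨a, ha, rfl⟩)
      · exact Or.inr (Or.inl ⟨a, ha, rfl⟩)
    · by_cases hd : d ∈ G
      · exact Or.inl (Or.inr ⟨d, hd, rfl⟩)
      · exact Or.inr (Or.inr ⟨d, hd, rfl⟩)
  have hdisj : ∀ p, p ∈ U → p ∈ V → False := by
    rintro p (⟨a, ha, rfl⟩ | ⟨d, hd, rfl⟩) hpV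
    · rcases hpV with ⟨a', ha', he⟩ | ⟨d, hd, he⟩
      · exact ha' (hfi he ▸ ha)
      · -- `f a = g d` with `a ∈ C`, `d ∉ G`: but `d ∈ T` witnesses `d ∈ G`
        exact hd ⟨d, mem_connectedComponent, hmemT he.symm, ⟨a, ha, he.symm⟩⟩
    · rcases hpV with ⟨a', ha', he⟩ | ⟨d', hd', he⟩
      · -- `g d = f a'` with `d ∈ G`, `a' ∉ C`: the preconnected trace meets both pieces
        obtain ⟨d₀, hd₀, hd₀T, hd₀C⟩ := hd
        have hdT : d ∈ T := hmemT he
        set P : Set M := g '' (T ∩ connectedComponent d) with hPdef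
        have hP : IsPreconnected P := (hT d).1.image g hg.continuousOn
        have hPf : P ⊆ f '' C ∪ f '' Cᶜ := by
          rw [← hrf]
          rintro _ ⟨x, ⟨hxT, -⟩, rfl⟩
          exact (hseam.symm ▸ ⟨x, hxT, rfl⟩ : g x ∈ range f ∩ range g).1
        have hP0 : P ∩ (f '' C ∩ f '' Cᶜ) = ∅ := by rw [hdf, inter_empty]
        have hgd₀ : g d₀ ∈ P := ⟨d₀, ⟨hd₀T, hd₀⟩, rfl⟩
        have hgd : g d ∈ P := ⟨d, ⟨hdT, mem_connectedComponent⟩, rfl⟩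
        rcases isPreconnected_iff_subset_of_disjoint_closed.1 hP _ _ (hfc _ hC.1)
            (hfc _ hC.compl.1) hPf hP0 with h | h
        · obtain ⟨a, ha, hae⟩ := h hgd
          exact ha' (hfi (hae.trans he.symm) ▸ ha)
        · obtain ⟨a, ha, hae⟩ := h hgd₀
          obtain ⟨a₀, ha₀, ha₀e⟩ := hd₀C
          exact ha (hfi (hae.trans ha₀e.symm) ▸ ha₀)
      · exact hd' (hgi he ▸ hd)
  have h0 : (univ : Set M) ∩ (U ∩ V) = ∅ := by
    rw [univ_inter]
    exact eq_empty_of_forall_notMem fun p hp => hdisj p hp.1 hp.2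
  -- `M` is connected: it lies in `U` or in `V`
  obtain ⟨a₁, ha₁⟩ := nonempty_iff_ne_empty.2 hC0
  obtain ⟨a₂, ha₂⟩ : (Cᶜ : Set A).Nonempty := nonempty_compl.2 hC1
  rcases isPreconnected_iff_subset_of_disjoint_closed.1 isPreconnected_univ U V hU hV hUV h0
    with h | h
  · exact hdisj _ (h (mem_univ (f a₂))) (Or.inl ⟨a₂, ha₂, rfl⟩)
  · exact hdisj _ (Or.inl ⟨a₁, ha₁, rfl⟩) (h (mem_univ (f a₁)))

/-- **Helper `helper_connected_seam` (glue G0 of the dictionary READ).**  For a Stein bisection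
`M = e₁(W₁) ∪ e₂(W₂)` of a homotopy `4`-sphere `M ≃ₕ S⁴` into two smoothly embedded compact
Stein domains meeting exactly along the images of their boundaries, both halves `W₁`, `W₂`
and the carrier of every boundary datum `b₁` of `W₁` are connected: `M` is connected (homotopy
equivalent to `S⁴`), every component of a compact Stein domain meets the boundary in a nonempty
preconnected set (`SteinStructure.isPreconnected_boundary_inter_compOpens`), and the abstract
gluing lemma `connectedSpace_of_closed_bisection` applies to `(e₁, e₂, ∂W₂)` and to
`(e₂, e₁, ∂W₁)`; then `∂W₁` is nonempty preconnected and `b₁.incl` is an embedding onto it.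
[folklore] -/
theorem helper_connected_seam (M : Type) [TopologicalSpace M] [T2Space M]
    [SecondCountableTopology M] [ChartedSpace E4 M] [IsManifold (𝓡 4) ∞ M] (hM : M ≃ₕ 𝕊⁴)
    (W₁ : Type) [TopologicalSpace W₁] [ChartedSpace (EuclideanHalfSpace 4) W₁]
    [IsManifold (𝓡∂ 4) ∞ W₁] [CompactSpace W₁]
    (W₂ : Type) [TopologicalSpace W₂] [ChartedSpace (EuclideanHalfSpace 4) W₂]
    [IsManifold (𝓡∂ 4) ∞ W₂] [CompactSpace W₂]
    (J₁ : SteinStructure W₁) (J₂ : SteinStructure W₂) (e₁ : W₁ → M) (e₂ : W₂ → M)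
    (he₁ : Manifold.IsSmoothEmbedding (𝓡∂ 4) (𝓡 4) ∞ e₁)
    (he₂ : Manifold.IsSmoothEmbedding (𝓡∂ 4) (𝓡 4) ∞ e₂)
    (hcover : range e₁ ∪ range e₂ = univ)
    (hseam₁ : range e₁ ∩ range e₂ = e₁ '' (𝓡∂ 4).boundary W₁)
    (hseam₂ : range e₁ ∩ range e₂ = e₂ '' (𝓡∂ 4).boundary W₂)
    (b₁ : BoundaryData (𝓡∂ 4) W₁ (𝓡 3)) :
    ConnectedSpace W₁ ∧ ConnectedSpace W₂ ∧ ConnectedSpace b₁.carrier := by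
  -- point-set structure inherited from the embeddings into the Hausdorff `M`
  haveI : T2Space W₁ := he₁.isEmbedding.t2Space
  haveI : T2Space W₂ := he₂.isEmbedding.t2Space
  haveI : LocallyConnectedSpace W₁ := locallyConnectedSpace_of_chartedSpace W₁
  haveI : LocallyConnectedSpace W₂ := locallyConnectedSpace_of_chartedSpace W₂
  -- `M` is connected: `S⁴` is path connected and `M ≃ₕ S⁴`
  have hrank : 1 < Module.rank ℝ (EuclideanSpace ℝ (Fin 5)) := by
    rw [← Module.finrank_eq_rank, finrank_euclideanSpace, Fintype.card_fin]
    norm_num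
  haveI : PathConnectedSpace 𝕊⁴ :=
    isPathConnected_iff_pathConnectedSpace.1 (isPathConnected_sphere hrank 0 zero_le_one)
  haveI : PathConnectedSpace M := pathConnectedSpace_of_homotopyEquiv' hM
  -- every component of a compact Stein domain meets the boundary in a nonempty preconnected set
  have hT₁ : ∀ d : W₁, IsPreconnected ((𝓡∂ 4).boundary W₁ ∩ connectedComponent d) ∧
      ((𝓡∂ 4).boundary W₁ ∩ connectedComponent d).Nonempty := fun d => by
    simpa only [coe_compOpens_mk] using
      J₁.isPreconnected_boundary_inter_compOpens (ConnectedComponents.mk d)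
  have hT₂ : ∀ d : W₂, IsPreconnected ((𝓡∂ 4).boundary W₂ ∩ connectedComponent d) ∧
      ((𝓡∂ 4).boundary W₂ ∩ connectedComponent d).Nonempty := fun d => by
    simpa only [coe_compOpens_mk] using
      J₂.isPreconnected_boundary_inter_compOpens (ConnectedComponents.mk d)
  -- the two halves
  have h₁ : ConnectedSpace W₁ :=
    connectedSpace_of_closed_bisection he₁.isEmbedding.injective
      he₁.isEmbedding.continuous.isClosedMap he₂.isEmbedding.continuous
      he₂.isEmbedding.injective he₂.isEmbedding.continuous.isClosedMap _ hcover hseam₂ hT₂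
  have h₂ : ConnectedSpace W₂ :=
    connectedSpace_of_closed_bisection he₂.isEmbedding.injective
      he₂.isEmbedding.continuous.isClosedMap he₁.isEmbedding.continuous
      he₁.isEmbedding.injective he₁.isEmbedding.continuous.isClosedMap _
      (union_comm (range e₁) _ ▸ hcover) (inter_comm (range e₁) _ ▸ hseam₁) hT₁
  refine ⟨h₁, h₂, ?_⟩
  -- the seam: `∂W₁ = ∂W₁ ∩ W₁` is nonempty preconnected, and `b₁.incl` embeds onto it
  obtain ⟨x⟩ := h₁.toNonempty
  have hb : IsPreconnected ((𝓡∂ 4).boundary W₁) ∧ ((𝓡∂ 4).boundary W₁).Nonempty := by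
    simpa only [PreconnectedSpace.connectedComponent_eq_univ, inter_univ] using hT₁ x
  rw [← b₁.range_incl] at hb
  refine connectedSpace_iff_univ.2 ⟨?_, ?_⟩
  · obtain ⟨_, ⟨z, -⟩⟩ := hb.2
    exact ⟨z, mem_univ z⟩
  · rw [← b₁.isSmoothEmbedding.isEmbedding.isInducing.isPreconnected_image, image_univ]
    exact hb.1

end Summit.SmoothPoincare4.SmoothPoincare4.Theorems.PlanarAcyclicBisectionRigidity.Sketch

end
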